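import Summits.Ventures.PercRepro.ProfileTwoCosimple

/-!
# PercRepro — THE ROW `q = 2` OF THE PROFILE INEQUALITY ON EVERY SIMPLE MATROID REDUCES TO ITS INDEPENDENT HALF
(p10, gen 2; S5 §2.5 Theorem B in general, and the kernel bridge of the open piece)

`proofs/SUBCLAIM-S5-p10.md` §2.5.  Theorem B for every SIMPLE matroid (no cogirth hypothesis): the demand of the
fat rank-`2` sets is at most `C(u,2)` times the number of dependent rank-`u` sets.  The injection
`(B, Y) ↦ B ∪ Y` of `ProfileTwoCosimple` charges each dependent rank-`u` set at most once, `M / B` has rank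
`ρ(E) − 2` so has `≥ C(ρ(E) − 2, u − 2)` independent `(u−2)`-sets, and the binomial inequality
`C(u,2) · C(R−2, u−2) ≥ C(R, u−2)` (i.e. `a(a+1)(b+1)(b+2) ≥ 2(a+b)(a+b+1)` for `a = u−1 ≥ 1`, `b = R−u ≥ 0`)
pays the demand `≤ C(R, u−2)`.  Hence, on every simple matroid, `(Π_{2,u})` follows from the independent half
`INDEP_{2,u}` alone — the kernel form of the open piece of the row `q = 2` (series pairs, coloops).

* `mul_ineq` — the polynomial inequality;
* `choose_le_choose_two_mul_choose` — `C(R, u−2) ≤ C(u,2) · C(R−2, u−2)` for `2 ≤ u ≤ R`;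
* `fat_demand_le_choose_mul_card_depU` — Theorem B on every simple matroid;
* **`profileIneq_two_of_indep`** — `INDEP_{2,u} → (Π_{2,u})` on every simple matroid.
-/

open scoped Matroid

namespace PercRepro.Cogirth

open Finset ThmH Skew Shadow Profile

variable {α : Type} [DecidableEq α] {M : Matroid α} [M.Finite]

/-! ### The binomial inequality -/

/-- `a(a+1)(b+1)(b+2) ≥ 2(a+b)(a+b+1)` for `a ≥ 1`, `b ≥ 0` (equality at `a = 1`). -/
theorem mul_ineq (a b : ℕ) (ha : 1 ≤ a) :
    2 * (a + b) * (a + b + 1) ≤ a * (a + 1) * (b + 1) * (b + 2) := by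
  rcases Nat.lt_or_ge a 2 with h | h
  · have ha1 : a = 1 := by omega
    subst ha1
    exact Nat.le_of_eq (by ring)
  · have h1 : 2 * (a + b) ≤ a * (b + 2) := by nlinarith
    have h2 : a + b + 1 ≤ (a + 1) * (b + 1) := by nlinarith
    calc 2 * (a + b) * (a + b + 1) ≤ (a * (b + 2)) * ((a + 1) * (b + 1)) := Nat.mul_le_mul h1 h2
      _ = a * (a + 1) * (b + 1) * (b + 2) := by ring

/-- `C(R, u−2) ≤ C(u,2) · C(R−2, u−2)` for `2 ≤ u ≤ R`. -/
theorem choose_le_choose_two_mul_choose {u R : ℕ} (hu : 2 ≤ u) (huR : u ≤ R) :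
    R.choose (u - 2) ≤ u.choose 2 * (R - 2).choose (u - 2) := by
  obtain ⟨k, rfl⟩ : ∃ k, u = k + 2 := ⟨u - 2, by omega⟩
  obtain ⟨b, rfl⟩ : ∃ b, R = k + 2 + b := ⟨R - (k + 2), by omega⟩
  rw [show k + 2 - 2 = k by omega, show k + 2 + b - 2 = k + b by omega]
  have e1 := Nat.choose_succ_right_eq (k + 2 + b) k
  rw [show k + 2 + b - k = b + 2 by omega] at e1
  have e2 := Nat.choose_succ_right_eq (k + 2 + b) (k + 1)
  rw [show k + 2 + b - (k + 1) = b + 1 by omega] at e2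
  have e3 := Nat.choose_mul (n := k + 2 + b) (k := k + 2) (s := 2) (by omega)
  rw [show k + 2 + b - 2 = k + b by omega, show k + 2 - 2 = k by omega] at e3
  have two_dvd_1 : 2 ∣ (k + 2) * (k + 1) := by
    rw [Nat.mul_comm]
    exact (Nat.even_mul_succ_self (k + 1)).two_dvd
  have two_dvd_2 : 2 ∣ (k + 2 + b) * (k + 1 + b) := by
    rw [show (k + 2 + b) * (k + 1 + b) = (k + 1 + b) * ((k + 1 + b) + 1) by ring]
    exact (Nat.even_mul_succ_self (k + 1 + b)).two_dvd
  have hk2 : (k + 2).choose 2 * 2 = (k + 2) * (k + 1) := by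
    rw [Nat.choose_two_right, show k + 2 - 1 = k + 1 by omega]
    exact Nat.div_mul_cancel two_dvd_1
  have hb2 : (k + 2 + b).choose 2 * 2 = (k + 2 + b) * (k + 1 + b) := by
    rw [Nat.choose_two_right, show k + 2 + b - 1 = k + 1 + b by omega]
    exact Nat.div_mul_cancel two_dvd_2
  have hA : (k + 2 + b).choose k * ((b + 2) * (b + 1)) =
      2 * ((k + 2 + b).choose 2 * (k + b).choose k) := by
    calc (k + 2 + b).choose k * ((b + 2) * (b + 1))
        = ((k + 2 + b).choose k * (b + 2)) * (b + 1) := by ring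
      _ = ((k + 2 + b).choose (k + 1) * (k + 1)) * (b + 1) := by rw [e1]
      _ = ((k + 2 + b).choose (k + 1) * (b + 1)) * (k + 1) := by ring
      _ = ((k + 2 + b).choose (k + 2) * (k + 2)) * (k + 1) := by rw [e2]
      _ = (k + 2 + b).choose (k + 2) * ((k + 2) * (k + 1)) := by ring
      _ = (k + 2 + b).choose (k + 2) * ((k + 2).choose 2 * 2) := by rw [hk2]
      _ = 2 * ((k + 2 + b).choose (k + 2) * (k + 2).choose 2) := by ring
      _ = 2 * ((k + 2 + b).choose 2 * (k + b).choose k) := by rw [e3]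
  have hineq := mul_ineq (k + 1) b (by omega)
  refine Nat.le_of_mul_le_mul_right (c := (b + 2) * (b + 1) * 2) ?_ (by positivity)
  calc (k + 2 + b).choose k * ((b + 2) * (b + 1) * 2)
      = ((k + 2 + b).choose k * ((b + 2) * (b + 1))) * 2 := by ring
    _ = 2 * ((k + 2 + b).choose 2 * (k + b).choose k) * 2 := by rw [hA]
    _ = 2 * ((k + 2 + b).choose 2 * 2) * (k + b).choose k := by ring
    _ = 2 * ((k + 2 + b) * (k + 1 + b)) * (k + b).choose k := by rw [hb2]
    _ = (2 * (k + 1 + b) * (k + 1 + b + 1)) * (k + b).choose k := by ring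
    _ ≤ ((k + 1) * (k + 1 + 1) * (b + 1) * (b + 2)) * (k + b).choose k :=
        Nat.mul_le_mul_right _ hineq
    _ = (k + b).choose k * ((b + 2) * (b + 1)) * ((k + 2) * (k + 1)) := by ring
    _ = (k + b).choose k * ((b + 2) * (b + 1)) * ((k + 2).choose 2 * 2) := by rw [hk2]
    _ = (k + 2).choose 2 * (k + b).choose k * ((b + 2) * (b + 1) * 2) := by ring

/-! ### Theorem B on every simple matroid, and the bridge -/

/-- **Theorem B (every simple matroid)**: `Σ_{B fat} demand(B) ≤ C(u,2) · #depU` for `2 ≤ u ≤ ρ(E)`. -/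
theorem fat_demand_le_choose_mul_card_depU (hs : Simple' M) {u : ℕ} (hu : 2 ≤ u) (huR : u ≤ rk M (gr M)) :
    ∑ B ∈ fat2 M, demand M 2 u B ≤ u.choose 2 * (depU M u).card := by
  have hterm : ∀ B ∈ fat2 M, demand M 2 u B ≤ u.choose 2 * (indepSets (M ／ (B : Set α)) (u - 2)).card := by
    intro B hB
    have hBg : B ⊆ gr M := (mem_Rq.1 (mem_fat2.1 hB).1).1
    have hrkB : rk M B = 2 := rk_eq_of_mem_Rq (mem_fat2.1 hB).1
    have hrk := rk_gr_contract_add_rk hBg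
    rw [hrkB] at hrk
    -- `C(ρ(E) − 2, u − 2) ≤ I_{u−2}(M / B)` (the subsets of a basis)
    have hA := choose_rk_le_card_indepSets (M := M ／ (B : Set α)) (u - 2)
    have hrk' : rk (M ／ (B : Set α)) (gr (M ／ (B : Set α))) = rk M (gr M) - 2 := by omega
    rw [hrk'] at hA
    have hdem : demand M 2 u B ≤ (rk M (gr M)).choose (u - 2) := by
      unfold demand
      split_ifs with h
      · apply Nat.choose_le_choose
        exact rk_mono' (M := M) (sdiff_subset : gr M \ B ⊆ gr M)
      · exact Nat.zero_le _
    calc demand M 2 u B ≤ (rk M (gr M)).choose (u - 2) := hdem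
      _ ≤ u.choose 2 * (rk M (gr M) - 2).choose (u - 2) := choose_le_choose_two_mul_choose hu huR
      _ ≤ u.choose 2 * (indepSets (M ／ (B : Set α)) (u - 2)).card := Nat.mul_le_mul_left _ hA
  calc ∑ B ∈ fat2 M, demand M 2 u B
      ≤ ∑ B ∈ fat2 M, u.choose 2 * (indepSets (M ／ (B : Set α)) (u - 2)).card := sum_le_sum hterm
    _ = u.choose 2 * ∑ B ∈ fat2 M, (indepSets (M ／ (B : Set α)) (u - 2)).card := by rw [mul_sum]
    _ = u.choose 2 * (fatPairs M u).card := by rw [card_fatPairs u]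
    _ ≤ u.choose 2 * (depU M u).card := Nat.mul_le_mul_left _ (card_fatPairs_le_card_depU hs hu)

/-- **THE BRIDGE**: on every simple matroid, the independent half `INDEP_{2,u}` implies `(Π_{2,u})`. -/
theorem profileIneq_two_of_indep (hs : Simple' M) (u : ℕ) (hu : 2 ≤ u)
    (hI : u ≤ rk M (gr M) → ∑ B ∈ indepSets M 2, demand M 2 u B ≤ u.choose 2 * (indepSets M u).card) :
    ProfileIneq M 2 u := by
  unfold ProfileIneq
  rcases Nat.lt_or_ge (rk M (gr M)) u with hlt | huR
  · have hzero : ∀ B ∈ Rq M 2, price M 2 u B = 0 := by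
      intro B _
      unfold price
      rw [if_neg]
      intro h
      rw [← coe_rk] at h
      have h' : u ≤ rk M (gr M \ B) := by exact_mod_cast h
      have := rk_mono' (M := M) (sdiff_subset : gr M \ B ⊆ gr M)
      omega
    rw [sum_eq_zero hzero]
    exact Nat.cast_nonneg _
  have hpos : (0 : ℚ) < (u.choose 2 : ℚ) := by
    exact_mod_cast Nat.choose_pos hu
  apply le_of_mul_le_mul_left _ hpos
  rw [mul_sum]
  simp_rw [choose_mul_price_eq_demand 2 u hu]
  rw [Rq_two_eq_union, sum_union disjoint_indepSets_fat2, levelSet_eq_union u,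
    card_union_of_disjoint (disjoint_indepSets_depU u)]
  have h1 := hI huR
  have h2 := fat_demand_le_choose_mul_card_depU hs hu huR
  have h4 : ∑ B ∈ indepSets M 2, demand M 2 u B + ∑ B ∈ fat2 M, demand M 2 u B ≤
      u.choose 2 * ((indepSets M u).card + (depU M u).card) := by
    rw [Nat.mul_add]
    exact Nat.add_le_add h1 h2
  exact_mod_cast h4

end PercRepro.Cogirth
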